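import Literature.Probability.Percolation.TriBoundaryWinding
import Literature.Topology.PlaneTopology.AnnulusArcs
import HarnessLib

/-!
# The boundary polyline of a union of tiles winds once about each of its faces

Topic `Literature/Probability/Percolation`; family `crit-perc`. The orientation of the boundary
traversal of a discrete domain (Bollobás–Riordan, *Percolation* (2006), Ch. 7 p. 169: "as `∂⁻(G)`
is traversed anticlockwise"; p. 191: "Let us trace the boundary of `G_δ⁻` anticlockwise"), in
metric form: for a disc `G ⊆ 𝕋` which is a union of tiles over a connected coarse set without
holes, the closed polyline through the mesh points of the successive tails of its boundary
traversal (`tailPoly δ G b 0 #∂G`) has **winding number `1` about the centre of every face of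
`G`** (`wind_bdryLoop_meshCenter_eq_one`), and winding number `0` about points joined to far away
off the polyline.

Proof: across the exit edge of the run of a tail the winding number jumps by `1`
(`crossInc_segment_side_mesh`, uniqueness of tail steps `tailStep_pair_eq`); the centre of the face
off `G` across that edge is joined, off the polyline, to its outside vertex and from there through
sites off `G` (no holes) to a far site, about which the winding number vanishes
(`wind_sub_eq_zero_of_dist_le`); the centres of the faces of `G` are joined to each other off the
polyline through the faces of `G` (`pathIn_triFacesIn_tileUnion`).

## References

* B. Bollobás, O. Riordan, *Percolation*, Cambridge University Press (2006), Ch. 7 §7.2.2 p. 169,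
  §7.2.5 p. 191.

## Mathlib / tree

Mathlib: `Finset.exists_max_image`, `connectedComponentIn`. Tree: `TriBoundaryWinding.lean`
(`run_window`, `not_mem_centreSeg_of_mem_tailStep`, `AvoidsMeshOf.not_mem_tailStep`,
`meshCenter_mem_connectedComponentIn_of_pathIn`), `TriTailPolyline.lean` (`tailPoly`,
`crossInc_tailPoly`), `ArgumentIncrement.lean` (`Path.crossInc_loop`,
`wind_sub_eq_of_mem_connectedComponentIn`), `AnnulusArcs.lean` (`wind_sub_eq_zero_of_dist_le`),
`TriTethers.lean` (`exists_path_of_reflTransGen`, `avoidsMeshOf_of_mem_meshEdgeSet`),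
`TriLatticeSegments.lean` (`eq_vertex_of_segment_inter_segment_hexCenter_faceVertex`).
-/

noncomputable section

open Set Metric Complex Filter Topology Literature.Topology.PlaneTopology Literature.Probability.LatticeModels
  Literature.Probability.RandomPlanarGeometry

namespace Literature.Probability.Percolation

open RemovableAt (hexFaceVertices_leftFaceDir exists_offset)

/-! ### Loops with propositionally equal endpoints -/

/-- `Path.crossInc_loop` for a path whose endpoints are only propositionally equal. [folklore] -/
theorem crossInc_eq_wind_sub_of_eq {x y : ℂ} (γ : Path x y) (hxy : y = x) {ℓ r : ℂ} (hl : ℓ ∉ range γ) (hr : r ∉ range γ) :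
    γ.crossInc ℓ r = (wind (fun t => γ.extend t - ℓ) - wind (fun t => γ.extend t - r)) * (2 * Real.pi * I) := by
  subst hxy
  exact Path.crossInc_loop γ hl hr

/-! ### Centre-to-vertex segments at mesh `δ` -/

/-- **At mesh `δ`: a closed mesh edge (or mesh point) meeting the segment from the scaled centre of
`F` to the mesh point of a vertex of `F` contains that vertex.** [folklore] -/
theorem eq_vertex_of_mem_segment_mesh {δ : ℝ} (hδ : δ ≠ 0) {F : HexVertex} {v : Fin 3} {a b : Site 2}
    (hab : a = b ∨ triGraph.Adj a b) {q : ℂ} (hq1 : q ∈ segment ℝ (triMeshPoint δ a) (triMeshPoint δ b))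
    (hq2 : q ∈ segment ℝ (meshCenter δ F) (triMeshPoint δ (faceVertex F v))) : faceVertex F v = a ∨ faceVertex F v = b := by
  rw [triMeshPoint, triMeshPoint, mem_segment_ofReal_mul_iff hδ] at hq1
  rw [meshCenter, triMeshPoint, mem_segment_ofReal_mul_iff hδ] at hq2
  exact eq_vertex_of_segment_inter_segment_hexCenter_faceVertex hab hq1 hq2

/-! ### Lattice paths off a union of tiles -/

/-- The centre of a tile is the tile centre of its central site. [folklore] -/
theorem tileCentre_coarseMul (c : Site 2) : tileCentre (coarseMul c) = c := by
  have := tileCentre_coarseMul_add_tileRep c 0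
  rwa [show tileRep 0 = 0 by decide, add_zero] at this

/-- **A coarse path off `S₀` gives a fine path off the union of tiles** (through the tiles of the
coarse path). [folklore] -/
theorem pathIn_compl_tileUnion_of_coarse {S₀ : Finset (Site 2)} {c c' : Site 2}
    (h : PathIn triGraph ((↑S₀ : Set (Site 2))ᶜ) c c') :
    PathIn triGraph ((↑(tileUnion S₀) : Set (Site 2))ᶜ) (coarseMul c) (coarseMul c') := by
  have hmem : ∀ x : Site 2, x ∈ ((↑(tileUnion S₀) : Set (Site 2))ᶜ) ↔ tileCentre x ∉ S₀ := fun x => by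
    rw [mem_compl_iff, Finset.mem_coe, mem_tileUnion_iff]
  obtain ⟨hc, h⟩ := h
  induction h with
  | refl => exact PathIn.refl ((hmem _).2 (by rw [tileCentre_coarseMul]; exact hc))
  | @tail b₁ b₂ hcb hb ih =>
    have hb₁ : b₁ ∉ S₀ := PathIn.right_mem (G := triGraph) ⟨hc, hcb⟩
    have hb₂ : b₂ ∉ S₀ := hb.2
    -- a fine path from the centre of the tile of `b₁` to that of `b₂` inside the two tiles
    set S' : Finset (Site 2) := {b₁, b₂} with hS'
    have hconn : ∀ x ∈ S', ∀ y ∈ S', PathIn triGraph (↑S' : Set (Site 2)) x y := by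
      intro x hx y hy
      have hx' := hx; have hy' := hy
      simp only [hS', Finset.mem_insert, Finset.mem_singleton] at hx' hy'
      rcases hx' with rfl | rfl <;> rcases hy' with rfl | rfl
      · exact PathIn.refl hx
      · exact PathIn.of_adj hx hy hb.1
      · exact PathIn.of_adj hx hy hb.1.symm
      · exact PathIn.refl hx
    have h1 : coarseMul b₁ ∈ tileUnion S' := mem_tileUnion_iff.2 (by rw [tileCentre_coarseMul]; simp [hS'])
    have h2 : coarseMul b₂ ∈ tileUnion S' := mem_tileUnion_iff.2 (by rw [tileCentre_coarseMul]; simp [hS'])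
    have hsub : (↑(tileUnion S') : Set (Site 2)) ⊆ (↑(tileUnion S₀) : Set (Site 2))ᶜ := by
      intro x hx
      rw [hmem]
      have hx' : tileCentre x ∈ S' := mem_tileUnion_iff.1 hx
      simp only [hS', Finset.mem_insert, Finset.mem_singleton] at hx'
      rcases hx' with h | h
      · exact h ▸ hb₁
      · exact h ▸ hb₂
    exact ih.trans ((pathIn_tileUnion hconn h1 h2).mono hsub)

/-- **Every site off a union of tiles is joined off it to the centre of its tile.** [folklore] -/
theorem pathIn_compl_tileUnion_coarseMul {S₀ : Finset (Site 2)} {x : Site 2} (hx : x ∉ tileUnion S₀) :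
    PathIn triGraph ((↑(tileUnion S₀) : Set (Site 2))ᶜ) x (coarseMul (tileCentre x)) := by
  set S' : Finset (Site 2) := {tileCentre x} with hS'
  have hc : tileCentre x ∉ S₀ := fun h => hx (mem_tileUnion_iff.2 h)
  have hconn : ∀ a ∈ S', ∀ b ∈ S', PathIn triGraph (↑S' : Set (Site 2)) a b := by
    intro a ha b hb
    have ha' := ha; have hb' := hb
    simp only [hS', Finset.mem_singleton] at ha' hb'
    subst ha'; subst hb'
    exact PathIn.refl ha
  have h1 : x ∈ tileUnion S' := mem_tileUnion_iff.2 (by simp [hS'])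
  have h2 : coarseMul (tileCentre x) ∈ tileUnion S' := mem_tileUnion_iff.2 (by rw [tileCentre_coarseMul]; simp [hS'])
  refine (pathIn_tileUnion hconn h1 h2).mono fun y hy => ?_
  rw [mem_compl_iff, Finset.mem_coe, mem_tileUnion_iff]
  have hy' : tileCentre y ∈ S' := mem_tileUnion_iff.1 hy
  simp only [hS', Finset.mem_singleton] at hy'
  rwa [hy']

/-! ### Boundary sites of a union of tiles -/

/-- **A nonempty union of tiles has two distinct sites with a neighbour off it** (a site with
maximal, and one with minimal, first coordinate). [folklore] -/
theorem exists_two_bdrySites {S₀ : Finset (Site 2)} (hne : S₀.Nonempty) :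
    ∃ g₁ ∈ tileUnion S₀, ∃ g₂ ∈ tileUnion S₀, g₁ ≠ g₂ ∧ g₁ + triDir 0 ∉ tileUnion S₀ ∧ g₂ + triDir 3 ∉ tileUnion S₀ := by
  set G := tileUnion S₀ with hG
  obtain ⟨c, hc⟩ := hne
  have hcG : coarseMul c ∈ G := mem_tileUnion_iff.2 (by rw [tileCentre_coarseMul]; exact hc)
  have hcG' : coarseMul c + triDir 0 ∈ G := mem_tileUnion_iff.2 (by
    rw [tileCentre_add_triDir, tilePhi_coarseMul, tileCentre_coarseMul, show tileOff 0 0 = 0 by decide, add_zero]; exact hc)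
  have hGne : G.Nonempty := ⟨_, hcG⟩
  obtain ⟨g₁, hg₁, hmax⟩ := Finset.exists_max_image G (fun g : Site 2 => g 0) hGne
  obtain ⟨g₂, hg₂, hmin⟩ := Finset.exists_min_image G (fun g : Site 2 => g 0) hGne
  have h0 : ∀ g : Site 2, (g + triDir 0) 0 = g 0 + 1 := fun g => by simp [triDir]
  have h3 : ∀ g : Site 2, (g + triDir 3) 0 = g 0 - 1 := fun g => by simp [triDir, sub_eq_add_neg]
  refine ⟨g₁, hg₁, g₂, hg₂, fun h => ?_, fun h => ?_, fun h => ?_⟩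
  · have h1 : (coarseMul c + triDir 0) 0 ≤ g₁ 0 := hmax _ hcG'
    have h2 : g₂ 0 ≤ (coarseMul c) 0 := hmin _ hcG
    rw [h0, h] at h1
    omega
  · have h1 : (g₁ + triDir 0) 0 ≤ g₁ 0 := hmax _ h
    rw [h0] at h1; omega
  · have h1 : g₂ 0 ≤ (g₂ + triDir 3) 0 := hmin _ h
    rw [h3] at h1; omega

/-- **The boundary traversal of a nonempty union of tiles has a genuine step** (two consecutive
distinct tails) within a period. [folklore] -/
theorem exists_tailStep {S₀ : Finset (Site 2)} {b : Site 2 × Site 2} (hD : IsTriDisc (tileUnion S₀) b) (hne : S₀.Nonempty) :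
    ∃ n < (triBdryDarts (tileUnion S₀)).card, bdryTail (tileUnion S₀) b n ≠ bdryTail (tileUnion S₀) b (n + 1) := by
  set G := tileUnion S₀ with hG
  obtain ⟨g₁, hg₁, g₂, hg₂, hne12, ho₁, ho₂⟩ := exists_two_bdrySites hne
  obtain ⟨m₁, hm₁, hd₁⟩ := hD.cycle (g₁, g₁ + triDir 0) (mem_triBdryDarts.2 ⟨hg₁, ho₁, triGraph_adj_add_triDir _ _⟩)
  obtain ⟨m₂, hm₂, hd₂⟩ := hD.cycle (g₂, g₂ + triDir 3) (mem_triBdryDarts.2 ⟨hg₂, ho₂, triGraph_adj_add_triDir _ _⟩)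
  have ht₁ : bdryTail G b m₁ = g₁ := by rw [bdryTail, hd₁]
  have ht₂ : bdryTail G b m₂ = g₂ := by rw [bdryTail, hd₂]
  by_contra hall
  push Not at hall
  have hconst : ∀ n ≤ (triBdryDarts G).card, bdryTail G b n = bdryTail G b 0 := by
    intro n hn
    induction n with
    | zero => rfl
    | succ n ih => rw [← hall n (by omega), ih (by omega)]
  exact hne12 (by rw [← ht₁, ← ht₂, hconst m₁ hm₁.le, hconst m₂ hm₂.le])

/-! ### The winding number of the boundary loop -/

/-- **The boundary polyline of a union of tiles winds once about the centre of each of its faces**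
(Bollobás–Riordan's anticlockwise traversal of `∂⁻G`, Ch. 7 p. 169, in metric form). Hypotheses:
`G = tileUnion S₀` is a disc traversed from `b`, over a nonempty connected coarse set `S₀` whose
complement is connected ("no holes"). [cite: BollobasRiordan2006, Ch. 7 §7.2.2 p. 169] -/
theorem wind_bdryLoop_meshCenter_eq_one {S₀ : Finset (Site 2)} {b : Site 2 × Site 2} (hD : IsTriDisc (tileUnion S₀) b)
    (hne : S₀.Nonempty) (hconn : ∀ c ∈ S₀, ∀ c' ∈ S₀, PathIn triGraph (↑S₀ : Set (Site 2)) c c')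
    (hholes : ∀ o ∉ S₀, ∀ o' ∉ S₀, PathIn triGraph ((↑S₀ : Set (Site 2))ᶜ) o o')
    {δ : ℝ} (hδ : 0 < δ) {F : HexVertex} (hF : hexFaceVertices F ⊆ tileUnion S₀) :
    wind (fun s => (tailPoly δ (tileUnion S₀) b 0 (triBdryDarts (tileUnion S₀)).card).extend s - meshCenter δ F) = 1 := by
  set N := (triBdryDarts (tileUnion S₀)).card with hN
  have hδ0 := hδ.ne'
  have hN0 : 0 < N := hD.card_pos
  set C := tailPoly δ (tileUnion S₀) b 0 N with hC
  have hC01 : tailPt δ (tileUnion S₀) b (0 + N) = tailPt δ (tileUnion S₀) b 0 := by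
    rw [tailPt, tailPt, zero_add, ← bdryTail_mod hD N, Nat.mod_self]
  have hext01 : C.extend 0 = C.extend 1 := by rw [Path.extend_zero, Path.extend_one, hC01]
  have hrem : ∀ u ∈ tileUnion S₀, (∃ j : Fin 6, u + triDir j ∉ tileUnion S₀) →
      ∃ a m : Fin 6, RemovableAt (tileUnion S₀) u a m ∧ m.val ≤ 4 := fun u hu hout => by
    obtain ⟨a, m, h, hm⟩ := exists_removableAt_of_mem_tileUnion hu hout
    exact ⟨a, m, h, by omega⟩
  -- off the loop: criteria
  have hoff : ∀ z, (∀ n, z ∉ segment ℝ (triMeshPoint δ (bdryTail (tileUnion S₀) b n)) (triMeshPoint δ (bdryTail (tileUnion S₀) b (n + 1)))) →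
      z ∉ range C := fun z hz =>
    not_mem_range_tailPoly δ (tileUnion S₀) b (fun h => hz 0 (h ▸ left_mem_segment _ _ _)) fun i _ => hz (0 + i)
  -- transport of the winding number along connected sets off the loop
  have hwind : ∀ {x y : ℂ}, y ∈ connectedComponentIn (range C)ᶜ x →
      wind (fun s => C.extend s - x) = wind (fun s => C.extend s - y) := fun {x y} hy =>
    wind_sub_eq_of_mem_connectedComponentIn (K := range C) C.continuous_extend.continuousOn hext01
      (isCompact_range C.continuous).isClosed (fun s hs => by rw [Path.extend_apply _ hs]; exact mem_range_self _) hy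
  have join : ∀ {x y : ℂ} {A : Set ℂ}, IsPreconnected A → A ⊆ (range C)ᶜ → x ∈ A → y ∈ A →
      y ∈ connectedComponentIn (range C)ᶜ x := fun hA hAS hx hy => hA.subset_connectedComponentIn hx hAS hy
  ---------------------------------------------------------------------------------------------
  -- a genuine step `n` and the two faces on its edge
  ---------------------------------------------------------------------------------------------
  obtain ⟨n, hnN, hne_n⟩ := exists_tailStep hD hne
  set u := bdryTail (tileUnion S₀) b n with hu
  have huG : u ∈ tileUnion S₀ := bdryTail_mem hD n
  obtain ⟨-, hhead, hadj⟩ := mem_triBdryDarts.1 (triBdryIter_mem hD.base_mem n)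
  obtain ⟨j', hj'⟩ := (triGraph_adj_iff_triDir _ _).1 hadj
  obtain ⟨a, m, hR, hm3⟩ := exists_removableAt_of_mem_tileUnion huG ⟨j', by rw [← bdryTail, ← hu] at hj'; exact hj' ▸ hhead⟩
  have hnext : bdryTail (tileUnion S₀) b (n + 1) = u + triDir (a + m) := (hR.tailStep_neighbours hD).2.1 n hne_n rfl
  set K := a + m with hK
  set g := u + triDir K with hg
  have hgne : u ≠ g := fun h => triDir_ne_zero K (by rw [hg] at h; exact (add_eq_left.1 h.symm))
  set Fe := leftFaceDir u K with hFe
  set j := jExit K with hj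
  set ℓ := meshCenter δ Fe with hℓ
  set r := meshCenter δ (oppFace Fe j) with hr
  have hFopp : oppFace Fe j = leftFaceDir u (K + 5) := oppFace_leftFaceDir_jExit u K
  have hfv1 : faceVertex Fe (j + 1) = u := faceVertex_leftFaceDir_jExit_succ u K
  have hfv2 : faceVertex Fe (j + 2) = g := faceVertex_leftFaceDir_jExit_succ_succ u K
  have hgG : g ∈ tileUnion S₀ := hR.inside le_rfl
  have hFeG : hexFaceVertices Fe ⊆ tileUnion S₀ := by
    rw [hFe, hexFaceVertices_leftFaceDir]
    intro x hx
    simp only [Finset.mem_insert, Finset.mem_singleton] at hx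
    rcases hx with rfl | rfl | rfl
    · exact huG
    · exact hgG
    · rw [hK, add_assoc]
      refine hR.inside ?_
      rw [Fin6.val_add_of_lt (by simp; omega)]; simp
  -- `ℓ`, `r` are off the loop
  have hℓ_step : ∀ k, ℓ ∉ segment ℝ (triMeshPoint δ (bdryTail (tileUnion S₀) b k)) (triMeshPoint δ (bdryTail (tileUnion S₀) b (k + 1))) :=
    fun k => meshCenter_not_mem_meshEdge hδ0 Fe ((bdryTail_succ_eq_or_adj hD k).imp Eq.symm id)
  have hr_step : ∀ k, r ∉ segment ℝ (triMeshPoint δ (bdryTail (tileUnion S₀) b k)) (triMeshPoint δ (bdryTail (tileUnion S₀) b (k + 1))) :=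
    fun k => meshCenter_oppFace_not_mem_meshEdge hδ0 Fe j ((bdryTail_succ_eq_or_adj hD k).imp Eq.symm id)
  have hℓC : ℓ ∉ range C := hoff ℓ hℓ_step
  have hrC : r ∉ range C := hoff r hr_step
  ---------------------------------------------------------------------------------------------
  -- the loop crosses `[ℓ, r]` once: `wind ℓ - wind r = 1`
  ---------------------------------------------------------------------------------------------
  have hcross : C.crossInc ℓ r = 2 * Real.pi * I := by
    rw [hC, crossInc_tailPoly δ (tileUnion S₀) b (fun h => hℓ_step 0 (by rw [h]; exact left_mem_segment _ _ _))
      (fun h => hr_step 0 (by rw [h]; exact left_mem_segment _ _ _)) (fun i _ => hℓ_step (0 + i)) (fun i _ => hr_step (0 + i)),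
      Finset.sum_eq_single n]
    · have e1 : tailPt δ (tileUnion S₀) b (0 + n) = triMeshPoint δ (faceVertex Fe (j + 1)) := by rw [zero_add, hfv1]; rfl
      have e2 : tailPt δ (tileUnion S₀) b (0 + n + 1) = triMeshPoint δ (faceVertex Fe (j + 2)) := by
        rw [zero_add, hfv2]; exact congrArg (triMeshPoint δ) hnext
      rw [e1, e2]
      exact crossInc_segment_side_mesh hδ Fe j
    · intro i hi hne
      refine Path.crossInc_eq_zero _ fun s hs => ?_
      have hz1 : (Path.segment (tailPt δ (tileUnion S₀) b (0 + i)) (tailPt δ (tileUnion S₀) b (0 + i + 1))) s ∈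
          segment ℝ (triMeshPoint δ (bdryTail (tileUnion S₀) b (0 + i))) (triMeshPoint δ (bdryTail (tileUnion S₀) b (0 + i + 1))) := by
        rw [← Path.range_segment]; exact mem_range_self s
      have hab := (bdryTail_succ_eq_or_adj hD (0 + i)).imp Eq.symm id
      have key : bdryTail (tileUnion S₀) b (0 + i) ≠ bdryTail (tileUnion S₀) b (0 + i + 1) ∧
          s(bdryTail (tileUnion S₀) b (0 + i), bdryTail (tileUnion S₀) b (0 + i + 1)) =
            s(bdryTail (tileUnion S₀) b n, bdryTail (tileUnion S₀) b (n + 1)) := by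
        rw [hnext]
        rcases eq_side_of_mem_segment_mesh hδ0 hab hz1 hs with ⟨h1, h2⟩ | ⟨h1, h2⟩ <;> rw [hfv1] at * <;> rw [hfv2] at * <;>
          rw [h1, h2]
        · exact ⟨hgne, rfl⟩
        · exact ⟨hgne.symm, Sym2.eq_swap⟩
      have hne' : bdryTail (tileUnion S₀) b n ≠ bdryTail (tileUnion S₀) b (n + 1) := by rw [hnext]; exact hgne
      have hmod := tailStep_pair_eq hD hrem key.1 hne' key.2
      have hik : i < N := Finset.mem_range.1 hi
      rw [zero_add, Nat.mod_eq_of_lt hik, Nat.mod_eq_of_lt hnN] at hmod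
      exact hne hmod
    · intro h; exact absurd (Finset.mem_range.2 hnN) h
  have hjump : wind (fun s => C.extend s - ℓ) - wind (fun s => C.extend s - r) = 1 := by
    have h := crossInc_eq_wind_sub_of_eq C hC01 hℓC hrC
    rw [hcross] at h
    have h' : ((wind (fun s => C.extend s - ℓ) - wind (fun s => C.extend s - r) : ℤ) : ℂ) = 1 := by
      have := mul_right_cancel₀ two_pi_I_ne_zero (h.symm.trans (one_mul _).symm)
      exact_mod_cast this
    exact_mod_cast h'
  ---------------------------------------------------------------------------------------------
  -- `wind r = 0`: `r` is joined off the loop to a far point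
  ---------------------------------------------------------------------------------------------
  -- the outside vertex `w' = u + e_{a+m-1}` of the face `F' = leftFaceDir u (K + 5)`
  set w' := u + triDir (K + 5) with hw'
  have hw'G : w' ∉ tileUnion S₀ := by
    rw [hw', hK, add_assoc, hR.out_iff]
    have := hR.one_le
    rw [Fin6.val_add_of_le (by simp; omega)]
    simp; omega
  have hw'F : w' ∈ hexFaceVertices (leftFaceDir u (K + 5)) := by rw [hexFaceVertices_leftFaceDir]; simp [hw']
  obtain ⟨v, hv⟩ := mem_hexFaceVertices_iff_faceVertex.1 hw'F
  -- (a) the segment from `r` to the mesh point of `w'` is off the loop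
  have hseg1 : segment ℝ r (triMeshPoint δ w') ⊆ (range C)ᶜ := by
    intro z hz
    refine hoff z fun k hz1 => ?_
    rw [hr, hFopp, hv] at hz
    have hab := (bdryTail_succ_eq_or_adj hD k).imp Eq.symm id
    rcases eq_vertex_of_mem_segment_mesh hδ0 hab hz1 hz with h | h
    · exact hw'G (hv ▸ h ▸ bdryTail_mem hD k)
    · exact hw'G (hv ▸ h ▸ bdryTail_mem hD (k + 1))
  -- (b) a far site `w∞` off `G`, beyond all mesh points of `G`
  obtain ⟨gmax, hgmax, hmax⟩ := Finset.exists_max_image (tileUnion S₀) (fun x : Site 2 => ‖triEmbed x‖) ⟨u, huG⟩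
  set B := ‖triEmbed gmax‖ with hB
  have hBG : ∀ x ∈ tileUnion S₀, ‖triMeshPoint δ x‖ ≤ δ * B := fun x hx => by
    rw [triMeshPoint, norm_mul, Complex.norm_real, Real.norm_eq_abs, abs_of_pos hδ]
    exact mul_le_mul_of_nonneg_left (hmax x hx) hδ.le
  set L : ℤ := ⌈B⌉ + 1 with hL
  set winf : Site 2 := fun i => ![L, 0] i with hwinf
  have hwinf_emb : triEmbed winf = (L : ℂ) := by simp [triEmbed, hwinf]
  have hwinf_norm : ‖triMeshPoint δ winf‖ = δ * L := by
    rw [triMeshPoint, hwinf_emb, norm_mul, Complex.norm_real, Real.norm_eq_abs, abs_of_pos hδ, Complex.norm_intCast,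
      abs_of_pos]
    have := Int.le_ceil B; push_cast [hL]; linarith [norm_nonneg (triEmbed gmax)]
  have hLB : B < L := by have := Int.le_ceil B; push_cast [hL]; linarith
  have hwinfG : winf ∉ tileUnion S₀ := fun h => by
    have := hBG winf h
    rw [hwinf_norm] at this
    nlinarith
  -- (c) a lattice path off `G` from `w'` to `w∞`, and a plane path along it, off the loop
  have hpath : PathIn triGraph ((↑(tileUnion S₀) : Set (Site 2))ᶜ) w' winf := by
    have h1 := pathIn_compl_tileUnion_coarseMul hw'G
    have h3 := (pathIn_compl_tileUnion_coarseMul hwinfG).symm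
    have hc1 : tileCentre w' ∉ S₀ := fun h => hw'G (mem_tileUnion_iff.2 h)
    have hc2 : tileCentre winf ∉ S₀ := fun h => hwinfG (mem_tileUnion_iff.2 h)
    exact (h1.trans (pathIn_compl_tileUnion_of_coarse (hholes _ hc1 _ hc2))).trans h3
  obtain ⟨-, P, hP⟩ := exists_path_of_reflTransGen δ hpath.1 hpath.2
  have hPoff : range P ⊆ (range C)ᶜ := fun z hz =>
    hoff z fun k => (avoidsMeshOf_of_mem_meshEdgeSet hδ0 (fun x hx hxG => absurd (Finset.mem_coe.2 hxG) hx) (hP hz)).not_mem_tailStep hD k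
  -- (d) the loop stays within `δ B` of the origin, so `wind w∞ = 0`
  have hwinf0 : wind (fun s => C.extend s - triMeshPoint δ winf) = 0 := by
    refine wind_sub_eq_zero_of_dist_le (x := 0) (r := δ * B) C.continuous_extend.continuousOn hext01 (fun s hs => ?_) ?_
    · rw [Path.extend_apply _ hs]
      have hmem := mem_range_self (f := C) ⟨s, hs⟩
      rw [hC, range_tailPoly] at hmem
      simp only [mem_union, mem_singleton_iff, mem_iUnion] at hmem
      rw [dist_zero_right]
      rcases hmem with h | ⟨i, -, h⟩
      · rw [h]; exact hBG _ (bdryTail_mem hD _)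
      · have h' := dist_le_of_mem_segment (c := (0 : ℂ)) (r := δ * B) (by rw [dist_zero_right]; exact hBG _ (bdryTail_mem hD _))
          (by rw [dist_zero_right]; exact hBG _ (bdryTail_mem hD _)) h
        rwa [dist_zero_right] at h'
    · rw [dist_zero_right, hwinf_norm]
      exact mul_lt_mul_of_pos_left hLB hδ
  have hr0 : wind (fun s => C.extend s - r) = 0 := by
    have h1 : triMeshPoint δ w' ∈ connectedComponentIn (range C)ᶜ r :=
      join (convex_segment _ _).isPreconnected hseg1 (left_mem_segment _ _ _) (right_mem_segment _ _ _)
    have hPext : (fun x : ℝ => P.extend x) '' Icc 0 1 ⊆ (range C)ᶜ := by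
      rintro z ⟨x, hx, rfl⟩
      show P.extend x ∈ (range C)ᶜ
      rw [Path.extend_apply _ hx]
      exact hPoff (mem_range_self _)
    have h2 : triMeshPoint δ winf ∈ connectedComponentIn (range C)ᶜ (triMeshPoint δ w') :=
      join (isPreconnected_Icc.image _ P.continuous_extend.continuousOn) hPext
        ⟨0, ⟨le_rfl, zero_le_one⟩, P.extend_zero⟩ ⟨1, ⟨zero_le_one, le_rfl⟩, P.extend_one⟩
    rw [hwind h1, hwind h2, hwinf0]
  have hℓ1 : wind (fun s => C.extend s - ℓ) = 1 := by rw [hr0] at hjump; simpa using hjump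
  ---------------------------------------------------------------------------------------------
  -- all faces of `G` have the winding number of `Fe`
  ---------------------------------------------------------------------------------------------
  have hGseg : ∀ (F : HexVertex) (j : Fin 3), hexFaceVertices F ⊆ tileUnion S₀ → hexFaceVertices (oppFace F j) ⊆ tileUnion S₀ →
      segment ℝ (meshCenter δ F) (meshCenter δ (oppFace F j)) ⊆ (range C)ᶜ := fun F j hF hF' z hz =>
    hoff z fun k hz1 => not_mem_centreSeg_of_mem_tailStep hD hδ0 hF hF' k hz1 hz
  have hmem : meshCenter δ F ∈ connectedComponentIn (range C)ᶜ ℓ :=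
    meshCenter_mem_connectedComponentIn_of_pathIn hGseg hℓC
      (pathIn_triFacesIn_tileUnion hconn (mem_triFacesIn.2 hFeG) (mem_triFacesIn.2 hF))
  rw [← hwind hmem, hℓ1]

end Literature.Probability.Percolation
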